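import Mathlib.GroupTheory.OrderOfElement
import Mathlib.Algebra.Group.Subgroup.ZPowers.Basic
import Mathlib.Algebra.Module.Basic
import Mathlib.Tactic
import HarnessLib

/-!
# Tian–Yuan–Zhang, proof of Theorem 3.5 (2): the group-theoretic skeleton ("LAYER A")

W2 of the `bsd-rank1-residual` P2 programme (p2-lead ML-48/ML-56; p2-monsky-lit GEN 8), file 2/6.
This file contains ONLY abstract additive-group lemmas: the elementary steps of the printed proof of
[TYZ, Thm. 3.5 (2)] (Y. Tian, X. Yuan, S.-W. Zhang, *Genus periods, genus points and congruent number
problem*, Asian J. Math. 21 (2017), arXiv:1411.4728, §3.5, chunk p0020 L107–L165, p0021 L1–L3), written for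
arbitrary abelian groups `GA` ("`A(ℍ′_n)`"), `GE` ("`E(ℍ′_n)`"), a homomorphism `ψ` ("the 2-isogeny
`φ : A → E`") whose kernel is `{0, τ(1)}`, commuting endomorphisms `N_A`, `N_E` ("`β′ + 1`"), and the
`τ`-table points with their ORDER relations only.  The point of the abstraction (idea-2's U⁺ note, second
reader p2-lit-1): the printed hypothesis "`P(n) ∈ A(K_n)⁻ + A[4]`" of Thm. 3.5's second bullet is NOT
needed — the `E`-side relation `2φ(P(n)) − εL·R ∈ E_tors` with `(β′+1)R = 0`, `R = φ(Q₁)` suffices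
(`exists_decomp_NA`), and the two bracket-parity conclusions (p0020 L141, p0021 L3) follow from the
bracket relation BEFORE the substitution of L122/L146 (`even_brackets_odd`, `even_iff_even_six`).

Nothing here mentions elliptic curves, BSD, or any Literature fact; no `def … : Prop`; all statements are
proved.  HONEST FRAMING: these lemmas are consumed by `UPlusOfGenusPointData` (file 6/6), where U⁺ becomes a
theorem MODULO the displayed printed statements `tyz_genusPointData` (p2-lit-1) and GZK by name.

## References
* Y. Tian, X. Yuan, S.-W. Zhang, *Genus periods, genus points and congruent number problem*, Asian J. Math.
  21 (2017) 721–774, arXiv:1411.4728; §3.5, proof of Thm. 3.5 (2). [TianYuanZhang2017]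
-/

namespace Literature.NumberTheory.EllipticCurves.TianYuanZhang2017.W2.Abstract

variable {GA GE : Type*} [AddCommGroup GA] [AddCommGroup GE]

/-- If `2 • y` has finite order then so does `y`. [cite: TianYuanZhang2017, proof of Thm. 3.5 (2) (chunk p0020 L107–L165, p0021 L1–L3)] -/
theorem isOfFinAddOrder_of_two_nsmul {y : GE} (h : IsOfFinAddOrder ((2 : ℕ) • y)) :
    IsOfFinAddOrder y := by
  obtain ⟨N, hN, hNy⟩ := h.exists_nsmul_eq_zero
  refine isOfFinAddOrder_iff_nsmul_eq_zero.mpr ⟨N * 2, by omega, ?_⟩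
  rwa [mul_nsmul']

/-- If `k • y` (`k ≠ 0`) has finite order then so does `y`. [cite: TianYuanZhang2017, proof of Thm. 3.5 (2) (chunk p0020 L107–L165, p0021 L1–L3)] -/
theorem isOfFinAddOrder_of_nsmul {y : GE} {k : ℕ} (hk : k ≠ 0)
    (h : IsOfFinAddOrder (k • y)) : IsOfFinAddOrder y := by
  obtain ⟨N, hN, hNy⟩ := h.exists_nsmul_eq_zero
  refine isOfFinAddOrder_iff_nsmul_eq_zero.mpr ⟨N * k, Nat.mul_pos hN (Nat.pos_of_ne_zero hk), ?_⟩
  rwa [mul_nsmul']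

/-- **K1 (abstract).** A homomorphism whose kernel consists of elements of finite order reflects
finite order ("a point whose `φ`-image is torsion is torsion: multiply by the order, land in
`ker φ ⊂ A[2]`", U-PLUS-PROOF-NOTE Step 3). [cite: TianYuanZhang2017, proof of Thm. 3.5 (2) (chunk p0020 L107–L165, p0021 L1–L3)] -/
theorem isOfFinAddOrder_of_map (ψ : GA →+ GE) (hker : ∀ x, ψ x = 0 → IsOfFinAddOrder x)
    {x : GA} (hx : IsOfFinAddOrder (ψ x)) : IsOfFinAddOrder x := by
  obtain ⟨N, hN, hNx⟩ := hx.exists_nsmul_eq_zero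
  have h1 : IsOfFinAddOrder (N • x) := hker _ (by rw [map_nsmul, hNx])
  exact isOfFinAddOrder_of_nsmul (Nat.pos_iff_ne_zero.mp hN) h1

/-- Membership in `ℤτ(1) = {0, τ(1)}` when `2 • τ1 = 0`. [cite: TianYuanZhang2017, proof of Thm. 3.5 (2) (chunk p0020 L107–L165, p0021 L1–L3)] -/
theorem mem_zmultiples_iff_of_two_nsmul_eq_zero {τ1 x : GA} (h2 : (2 : ℕ) • τ1 = 0) :
    x ∈ AddSubgroup.zmultiples τ1 ↔ x = 0 ∨ x = τ1 := by
  constructor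
  · rintro ⟨k, rfl⟩
    obtain ⟨j, hj | hj⟩ := Int.even_or_odd' k
    · left
      change k • τ1 = 0
      rw [hj, mul_comm, ← smul_smul, show (2 : ℤ) • τ1 = (2 : ℕ) • τ1 from by norm_cast, h2,
        smul_zero]
    · right
      change k • τ1 = τ1
      rw [hj, add_smul, one_smul, mul_comm, ← smul_smul,
        show (2 : ℤ) • τ1 = (2 : ℕ) • τ1 from by norm_cast, h2, smul_zero, zero_add]
  · rintro (rfl | rfl)
    · exact zero_mem _
    · exact AddSubgroup.mem_zmultiples _

/-- An integer multiple of an element of `ℤτ(1)` is in `ℤτ(1)`. [cite: TianYuanZhang2017, proof of Thm. 3.5 (2) (chunk p0020 L107–L165, p0021 L1–L3)] -/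
theorem zsmul_mem_zmultiples_of_mem {τ1 x : GA} (hx : x ∈ AddSubgroup.zmultiples τ1) (k : ℤ) :
    k • x ∈ AddSubgroup.zmultiples τ1 :=
  AddSubgroup.zsmul_mem _ hx k

/-- Elements of `ℤτ(1)` have finite order (when `2 • τ1 = 0`). [cite: TianYuanZhang2017, proof of Thm. 3.5 (2) (chunk p0020 L107–L165, p0021 L1–L3)] -/
theorem isOfFinAddOrder_of_mem_zmultiples {τ1 x : GA} (h2 : (2 : ℕ) • τ1 = 0)
    (hx : x ∈ AddSubgroup.zmultiples τ1) : IsOfFinAddOrder x := by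
  rcases (mem_zmultiples_iff_of_two_nsmul_eq_zero h2).mp hx with rfl | rfl
  · exact isOfFinAddOrder_iff_nsmul_eq_zero.mpr ⟨1, one_pos, smul_zero _⟩
  · exact isOfFinAddOrder_iff_nsmul_eq_zero.mpr ⟨2, by norm_num, h2⟩

/-- **The two `τ`-facts used for odd `n`** (TYZ p0020 L140–141: "the left-hand side lies in `ℤτ(1)`.
Thus the coefficients in both of the brackets must be even"): if `2•τa = 0`, `τa ∉ ℤτ(1)`,
`2•τb = τ1 ≠ 0`, `2•τ1 = 0`, then `a•τa + b•τb ∈ ℤτ(1)` forces `a` and `b` even. [cite: TianYuanZhang2017, proof of Thm. 3.5 (2) (chunk p0020 L107–L165, p0021 L1–L3)] -/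
theorem even_and_even_of_mem_zmultiples {τ1 τa τb : GA} (h2 : (2 : ℕ) • τ1 = 0) (hτ1 : τ1 ≠ 0)
    (hτa : (2 : ℕ) • τa = 0) (hτa' : τa ∉ AddSubgroup.zmultiples τ1) (hτb : (2 : ℕ) • τb = τ1)
    {a b : ℤ} (h : a • τa + b • τb ∈ AddSubgroup.zmultiples τ1) : Even a ∧ Even b := by
  -- doubling kills `ℤτ(1)` and `τa`, and sends `b • τb` to `b • τ1`
  have hb : Even b := by
    by_contra hb
    rw [Int.not_even_iff_odd] at hb
    obtain ⟨j, hj⟩ := hb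
    have h2x : (2 : ℕ) • (a • τa + b • τb) = 0 := by
      rcases (mem_zmultiples_iff_of_two_nsmul_eq_zero h2).mp h with h0 | h0
      · rw [h0, smul_zero]
      · rw [h0, h2]
    rw [smul_add, smul_comm (2 : ℕ) a τa, smul_comm (2 : ℕ) b τb, hτa, hτb, smul_zero, zero_add,
      hj, add_smul, one_smul, mul_comm, ← smul_smul,
      show (2 : ℤ) • τ1 = (2 : ℕ) • τ1 from by norm_cast, h2, smul_zero, zero_add] at h2x
    exact hτ1 h2x
  refine ⟨?_, hb⟩
  obtain ⟨j, hj⟩ := hb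
  have hbτ : b • τb ∈ AddSubgroup.zmultiples τ1 := by
    rw [hj, ← two_mul, mul_comm, ← smul_smul,
      show (2 : ℤ) • τb = (2 : ℕ) • τb from by norm_cast, hτb]
    exact AddSubgroup.zsmul_mem _ (AddSubgroup.mem_zmultiples τ1) j
  have haτ : a • τa ∈ AddSubgroup.zmultiples τ1 := by
    have := AddSubgroup.sub_mem _ h hbτ
    rwa [add_sub_cancel_right] at this
  by_contra ha
  rw [Int.not_even_iff_odd] at ha
  obtain ⟨j', hj'⟩ := ha
  rw [hj', add_smul, one_smul, mul_comm, ← smul_smul,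
    show (2 : ℤ) • τa = (2 : ℕ) • τa from by norm_cast, hτa, smul_zero, zero_add] at haτ
  exact hτa' haτ

/-- **The `τ`-fact used for `n ≡ 6 (mod 8)`** (TYZ p0021 L1–3: "the left-hand side lies in `A[2]`. It
follows that the first two coefficients have the same parity"): if `2•τc = 2•τb = τ1 ≠ 0`, `2•τ1 = 0`,
`2•τd = 0`, and `2 • (a•τc + b•τb + c•τd) = 0`, then `a ≡ b (mod 2)`. [cite: TianYuanZhang2017, proof of Thm. 3.5 (2) (chunk p0020 L107–L165, p0021 L1–L3)] -/
theorem even_iff_even_of_two_nsmul_eq_zero {τ1 τb τc τd : GA} (h2 : (2 : ℕ) • τ1 = 0) (hτ1 : τ1 ≠ 0)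
    (hτb : (2 : ℕ) • τb = τ1) (hτc : (2 : ℕ) • τc = τ1) (hτd : (2 : ℕ) • τd = 0) {a b c : ℤ}
    (h : (2 : ℕ) • (a • τc + b • τb + c • τd) = 0) : (Even a ↔ Even b) := by
  rw [smul_add, smul_add, smul_comm (2 : ℕ) a τc, smul_comm (2 : ℕ) b τb, smul_comm (2 : ℕ) c τd,
    hτb, hτc, hτd, smul_zero, add_zero, ← add_smul] at h
  -- `(a + b) • τ1 = 0` with `τ1` of order exactly `2` ⇒ `a + b` even
  have hab : Even (a + b) := by
    by_contra hab
    rw [Int.not_even_iff_odd] at hab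
    obtain ⟨j, hj⟩ := hab
    rw [hj, add_smul, one_smul, mul_comm, ← smul_smul,
      show (2 : ℤ) • τ1 = (2 : ℕ) • τ1 from by norm_cast, h2, smul_zero, zero_add] at h
    exact hτ1 h
  rw [Int.even_add] at hab
  exact hab


/-- **Steps 3–4 (abstract; both parities).** From the `E`-side `ρ`-free relation
`2•ψ(P) − (εL)•R ∈ tors` (Step 1E), `L = 2m`, a `ψ`-preimage `Q₁` of `R` (Step 2 / K2), the kernel
`ker ψ ⊆ {0, τ1}` (Lemma 3.16 / T2) and `ψ ∘ N_A = N_E ∘ ψ`, `N_E R = 0` (β′ acts by `−1` on `R`,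
Galois-equivariance of the isogeny): `N_A P = (εm) • N_A Q₁ + N_A t′` with `N_A Q₁ ∈ ℤτ(1)` and
`t′ := P − (εm)•Q₁` of finite order. [cite: TianYuanZhang2017, proof of Thm. 3.5 (2) (chunk p0020 L107–L165, p0021 L1–L3)] -/
theorem exists_decomp_NA (ψ : GA →+ GE) {τ1 : GA} (h2 : (2 : ℕ) • τ1 = 0)
    (hker : ∀ x, ψ x = 0 → x = 0 ∨ x = τ1)
    (NA : GA →+ GA) (NE : GE →+ GE) (hcomm : ∀ x, ψ (NA x) = NE (ψ x))
    {R : GE} (hR : NE R = 0) {Q₁ : GA} (hQ : ψ Q₁ = R)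
    {P : GA} {L ε m : ℤ} (hL : L = 2 * m)
    (hF1 : IsOfFinAddOrder ((2 : ℕ) • ψ P - (ε * L) • R)) :
    ∃ t' : GA, IsOfFinAddOrder t' ∧ NA Q₁ ∈ AddSubgroup.zmultiples τ1 ∧
      NA P = (ε * m) • NA Q₁ + NA t' := by
  have hkerT : ∀ x, ψ x = 0 → IsOfFinAddOrder x := by
    intro x hx
    rcases hker x hx with rfl | rfl
    · exact isOfFinAddOrder_iff_nsmul_eq_zero.mpr ⟨1, one_pos, smul_zero _⟩
    · exact isOfFinAddOrder_iff_nsmul_eq_zero.mpr ⟨2, by norm_num, h2⟩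
  -- Step 3: `t′ := P − (εm)•Q₁` has finite order
  set t' : GA := P - (ε * m) • Q₁ with ht'
  have hy : IsOfFinAddOrder (ψ t') := by
    have e : (2 : ℕ) • ψ t' = (2 : ℕ) • ψ P - (ε * L) • R := by
      rw [ht', map_sub, map_zsmul, hQ, hL]
      module
    exact isOfFinAddOrder_of_two_nsmul (e ▸ hF1)
  have ht'fin : IsOfFinAddOrder t' := isOfFinAddOrder_of_map ψ hkerT hy
  -- Step 4: `N_A Q₁ ∈ ker ψ`
  have hNQ : NA Q₁ ∈ AddSubgroup.zmultiples τ1 := by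
    have h0 : ψ (NA Q₁) = 0 := by rw [hcomm, hQ, hR]
    exact (mem_zmultiples_iff_of_two_nsmul_eq_zero h2).mpr (hker _ h0)
  refine ⟨t', ht'fin, hNQ, ?_⟩
  have hP : P = (ε * m) • Q₁ + t' := by rw [ht']; abel
  conv_lhs => rw [hP]
  rw [map_add, map_zsmul]

/-- **U⁺ deduction, odd `n` (classes 5 and 7), abstract form.** Hypotheses: the kernel of `ψ`
(Lemma 3.16), the torsion rules of Lemma 3.18 + `β′|ℚ(i) = id` in the form "`N_A t = 2•t` and
`2•t ∈ ℤτ(1)` for every torsion `t ∈ A(ℍ′_n)`", the `τ`-table facts `2•τa = 0`, `τa ∉ ℤτ(1)`,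
`2•τb = τ(1)`, the bracket relation of p0020 L127–134 BEFORE the substitution of L122 (i.e. with
`(β′+1)P(n)` still present): `B₅•τa + B₇•τb − N_A P(n) ∈ N_A(2A(ℍ′_n))`, and the `E`-side `ρ`-free
Step-1 relation. Conclusion: both brackets are even (p0020 L141) — WITHOUT `P(n) ∈ A(K_n)⁻ + A[4]`. [cite: TianYuanZhang2017, proof of Thm. 3.5 (2) (chunk p0020 L107–L165, p0021 L1–L3)] -/
theorem even_brackets_odd (ψ : GA →+ GE) {τ1 τa τb : GA} (h2 : (2 : ℕ) • τ1 = 0) (hτ1 : τ1 ≠ 0)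
    (hker : ∀ x, ψ x = 0 → x = 0 ∨ x = τ1)
    (hτa : (2 : ℕ) • τa = 0) (hτa' : τa ∉ AddSubgroup.zmultiples τ1) (hτb : (2 : ℕ) • τb = τ1)
    (NA : GA →+ GA) (NE : GE →+ GE) (hcomm : ∀ x, ψ (NA x) = NE (ψ x))
    (htor : ∀ t : GA, IsOfFinAddOrder t →
      NA t = (2 : ℕ) • t ∧ (2 : ℕ) • t ∈ AddSubgroup.zmultiples τ1)
    {R : GE} (hR : NE R = 0) {Q₁ : GA} (hQ : ψ Q₁ = R)
    {P : GA} {L ε : ℤ} (hF1 : IsOfFinAddOrder ((2 : ℕ) • ψ P - (ε * L) • R))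
    {B₅ B₇ : ℕ}
    (hF4 : ∃ (a : GA) (k : ℤ), (B₅ : ℤ) • τa + (B₇ : ℤ) • τb - NA P = NA ((2 : ℕ) • a) + k • τ1)
    (hL : Even L) : Even B₅ ∧ Even B₇ := by
  obtain ⟨m, hm⟩ := hL
  obtain ⟨t', ht', hNQ, hNP⟩ :=
    exists_decomp_NA ψ h2 hker NA NE hcomm hR hQ (m := m) (by rw [hm]; ring) hF1
  -- `N_A P ∈ ℤτ(1)`
  have hNPmem : NA P ∈ AddSubgroup.zmultiples τ1 := by
    rw [hNP, (htor t' ht').1]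
    exact AddSubgroup.add_mem _ (AddSubgroup.zsmul_mem _ hNQ _) (htor t' ht').2
  -- the contribution of `N_A (2A)` is torsion, hence in `2 A_tor ⊆ ℤτ(1)`
  obtain ⟨a, k, ha⟩ := hF4
  have hτ1fin : IsOfFinAddOrder τ1 := isOfFinAddOrder_iff_nsmul_eq_zero.mpr ⟨2, by norm_num, h2⟩
  have hlhs : IsOfFinAddOrder ((B₅ : ℤ) • τa + (B₇ : ℤ) • τb - NA P) := by
    rw [sub_eq_add_neg]
    refine IsOfFinAddOrder.add (IsOfFinAddOrder.add ?_ ?_) (isOfFinAddOrder_of_mem_zmultiples h2 hNPmem).neg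
    · exact (isOfFinAddOrder_iff_nsmul_eq_zero.mpr ⟨2, by norm_num, hτa⟩).zsmul
    · exact (isOfFinAddOrder_of_two_nsmul (hτb ▸ hτ1fin)).zsmul
  have hNa : IsOfFinAddOrder (NA a) := by
    have e : NA ((2 : ℕ) • a) = ((B₅ : ℤ) • τa + (B₇ : ℤ) • τb - NA P) + -(k • τ1) := by
      rw [ha]; abel
    have : IsOfFinAddOrder (NA ((2 : ℕ) • a)) := by rw [e]; exact hlhs.add hτ1fin.zsmul.neg
    rw [map_nsmul] at this
    exact isOfFinAddOrder_of_two_nsmul this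
  have h2Na : NA ((2 : ℕ) • a) ∈ AddSubgroup.zmultiples τ1 := by
    rw [map_nsmul]; exact (htor _ hNa).2
  have hsum : (B₅ : ℤ) • τa + (B₇ : ℤ) • τb ∈ AddSubgroup.zmultiples τ1 := by
    have e : (B₅ : ℤ) • τa + (B₇ : ℤ) • τb = NA ((2 : ℕ) • a) + k • τ1 + NA P := by
      rw [← ha, sub_add_cancel]
    rw [e]
    exact AddSubgroup.add_mem _ (AddSubgroup.add_mem _ h2Na
      (AddSubgroup.zsmul_mem _ (AddSubgroup.mem_zmultiples τ1) k)) hNPmem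
  obtain ⟨h5, h7⟩ := even_and_even_of_mem_zmultiples h2 hτ1 hτa hτa' hτb hsum
  exact ⟨(Int.even_coe_nat B₅).mp h5, (Int.even_coe_nat B₇).mp h7⟩

/-- **U⁺ deduction, `n ≡ 6 (mod 8)`, abstract form.** Torsion rules: `A(ℍ′_n)_tor = A[4]` and
`(β+1)A[4] = A[2]` (Lemma 3.18, p0020 L146; rider R-a: only the IDENTITY is assumed, for whichever `β`)
in the form "`4•t = 0` and `2 • N_A t = 0` for every torsion `t`"; the three-term bracket relation of
p0020 L152–164 with `(β′+1)P(n)` still present; `2•τc = 2•τb = τ(1)`, `2•τd = 0`. Conclusion: the first two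
brackets have the same parity (p0021 L3). [cite: TianYuanZhang2017, proof of Thm. 3.5 (2) (chunk p0020 L107–L165, p0021 L1–L3)] -/
theorem even_iff_even_six (ψ : GA →+ GE) {τ1 τb τc τd : GA} (h2 : (2 : ℕ) • τ1 = 0) (hτ1 : τ1 ≠ 0)
    (hker : ∀ x, ψ x = 0 → x = 0 ∨ x = τ1)
    (hτb : (2 : ℕ) • τb = τ1) (hτc : (2 : ℕ) • τc = τ1) (hτd : (2 : ℕ) • τd = 0)
    (NA : GA →+ GA) (NE : GE →+ GE) (hcomm : ∀ x, ψ (NA x) = NE (ψ x))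
    (htor : ∀ t : GA, IsOfFinAddOrder t → (4 : ℕ) • t = 0 ∧ (2 : ℕ) • NA t = 0)
    {R : GE} (hR : NE R = 0) {Q₁ : GA} (hQ : ψ Q₁ = R)
    {P : GA} {L ε : ℤ} (hF1 : IsOfFinAddOrder ((2 : ℕ) • ψ P - (ε * L) • R))
    {B₆ B₇₂ B₅₃₂ : ℕ}
    (hF4 : ∃ (a : GA) (k : ℤ),
      (B₆ : ℤ) • τc + (B₇₂ : ℤ) • τb + (B₅₃₂ : ℤ) • τd - NA P = NA ((2 : ℕ) • a) + k • τ1)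
    (hL : Even L) : (Even B₆ ↔ Even B₇₂) := by
  obtain ⟨m, hm⟩ := hL
  obtain ⟨t', ht', hNQ, hNP⟩ :=
    exists_decomp_NA ψ h2 hker NA NE hcomm hR hQ (m := m) (by rw [hm]; ring) hF1
  -- `2 • N_A P = 0`
  have h2NQ : (2 : ℕ) • NA Q₁ = 0 := by
    rcases (mem_zmultiples_iff_of_two_nsmul_eq_zero h2).mp hNQ with h0 | h0
    · rw [h0, smul_zero]
    · rw [h0, h2]
  have h2NP : (2 : ℕ) • NA P = 0 := by
    rw [hNP, smul_add, smul_comm, h2NQ, smul_zero, zero_add, (htor t' ht').2]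
  have hNPfin : IsOfFinAddOrder (NA P) := isOfFinAddOrder_iff_nsmul_eq_zero.mpr ⟨2, by norm_num, h2NP⟩
  obtain ⟨a, k, ha⟩ := hF4
  have hτ1fin : IsOfFinAddOrder τ1 := isOfFinAddOrder_iff_nsmul_eq_zero.mpr ⟨2, by norm_num, h2⟩
  have hlhs : IsOfFinAddOrder ((B₆ : ℤ) • τc + (B₇₂ : ℤ) • τb + (B₅₃₂ : ℤ) • τd - NA P) := by
    rw [sub_eq_add_neg]
    refine IsOfFinAddOrder.add (IsOfFinAddOrder.add (IsOfFinAddOrder.add ?_ ?_) ?_) hNPfin.neg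
    · exact (isOfFinAddOrder_of_two_nsmul (hτc ▸ hτ1fin)).zsmul
    · exact (isOfFinAddOrder_of_two_nsmul (hτb ▸ hτ1fin)).zsmul
    · exact (isOfFinAddOrder_iff_nsmul_eq_zero.mpr ⟨2, by norm_num, hτd⟩).zsmul
  have hNa : IsOfFinAddOrder (NA a) := by
    have e : NA ((2 : ℕ) • a) =
        ((B₆ : ℤ) • τc + (B₇₂ : ℤ) • τb + (B₅₃₂ : ℤ) • τd - NA P) + -(k • τ1) := by
      rw [ha]; abel
    have : IsOfFinAddOrder (NA ((2 : ℕ) • a)) := by rw [e]; exact hlhs.add hτ1fin.zsmul.neg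
    rw [map_nsmul] at this
    exact isOfFinAddOrder_of_two_nsmul this
  -- `N_A(2a) = 2 N_A a` with `N_A a ∈ A[4]`, so `2 • N_A(2a) = 0`
  have h2rhs : (2 : ℕ) • NA ((2 : ℕ) • a) = 0 := by
    rw [map_nsmul, smul_smul]
    exact (htor _ hNa).1
  have hsum : (2 : ℕ) • ((B₆ : ℤ) • τc + (B₇₂ : ℤ) • τb + (B₅₃₂ : ℤ) • τd) = 0 := by
    have e : (B₆ : ℤ) • τc + (B₇₂ : ℤ) • τb + (B₅₃₂ : ℤ) • τd = NA ((2 : ℕ) • a) + k • τ1 + NA P := by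
      rw [← ha, sub_add_cancel]
    rw [e, smul_add, smul_add, h2rhs, h2NP, add_zero, zero_add, smul_comm, h2, smul_zero]
  have key := even_iff_even_of_two_nsmul_eq_zero h2 hτ1 hτb hτc hτd hsum
  rw [Int.even_coe_nat, Int.even_coe_nat] at key
  exact key

end Literature.NumberTheory.EllipticCurves.TianYuanZhang2017.W2.Abstract
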